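import Summits.RiemannHypothesis.RiemannHypothesis.Theorems.WeilColumnThetaWitness
import Summits.RiemannHypothesis.RiemannHypothesis.Theorems.WeilColumnThetaPrimeSide
import Summits.RiemannHypothesis.RiemannHypothesis.Theorems.WeilColumnThetaPrimeTail
import HarnessLib

/-!
# THETA kernel certificate: the PRIME SIDE in the interface's currency — `primesC + cross`, with and WITHOUT Rosser–Schoenfeld (RH-FREE)

Cell `rh-explicit`, WEIL column, seat handoff-prove-2 gen12 (THETA-ASSIGN v1.0 §3 D6 restated; ATTEMPT-22 §5).  For the odd extension
`g = T − T(−·)` (a Weil test function supported in `[−a, a]`) of ANY tail `T` vanishing beyond `x₁ < 0` with envelope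
`‖T u‖ ≤ E e^{(m+½)(u−x₁)}` (the witness tail: `E² = M²u₁`, `x₁ = P.x₁`; its mollification: `x₁ ↦ x₁ + r`, `E ↦ E e^{(m+½)r}`,
cc-s2-3's `WeilColumnMollifierSup`), with `N = e^{−2x₁}`:

* `norm_weilPrimeTerm_oddTail_le`: **`‖weilPrimeTerm (g ⋆ g̃)‖ ≤ (2E²/(m+½))·vonMangoldtSum (m+1) + 2E²√N·C·(e^{−m/(m+1)}/(m+1) + 1/m²)`**
  under `ψ(x) ≤ C·x` on `[0,∞)` (Rosser–Schoenfeld: `C = rsConst`; = `P.primesC + P.cross` at `E² = M²u₁`, `u₁√N = 1`);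
* the sibling `WeilColumnThetaPrimeBoundsCheb` gives the SAME with `C = log 4 + 2·log N/√N` and NO hypothesis (ATTEMPT-22 §5).
Nothing here bears on the truth of RH.
-/

noncomputable section

set_option linter.dupNamespace false

open Complex Set MeasureTheory Filter
open scoped Real Topology ArithmeticFunction.vonMangoldt Chebyshev

namespace Summit.RiemannHypothesis.RiemannHypothesis.Theorems.WeilColumn.ThetaMellin

open Literature.NumberTheory.LFunctions

namespace ThetaParams

/-! ## §1 Partial sums of `Λ(n)/n^{m+1}` and the prime side under `ψ ≤ C·x` beyond `N` -/

/-- Partial sums of `Λ(n)/n^{m+1}` are below `vonMangoldtSum (m+1)` (`m ≥ 2`; `Λ(n) ≤ log n ≤ n`). -/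
theorem sum_vonMangoldt_div_pow_le {m : ℕ} (hm : 2 ≤ m) (K : ℕ) :
    ∑ n ∈ Finset.range K, (Λ n : ℝ) / (n : ℝ) ^ (m + 1) ≤ vonMangoldtSum (m + 1) := by
  have hnn : ∀ n : ℕ, 0 ≤ (Λ n : ℝ) / (n : ℝ) ^ (m + 1) := fun n ↦
    div_nonneg ArithmeticFunction.vonMangoldt_nonneg (by positivity)
  have hsum : Summable fun n : ℕ ↦ (Λ n : ℝ) / (n : ℝ) ^ (m + 1) := by
    refine Summable.of_nonneg_of_le hnn (fun n ↦ ?_) (Real.summable_one_div_nat_pow.2 (by omega : 1 < m))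
    rcases Nat.eq_zero_or_pos n with h0 | hpos
    · subst h0; simp
    have hn : (0 : ℝ) < n := by exact_mod_cast hpos
    have hΛ : (Λ n : ℝ) ≤ n := (ArithmeticFunction.vonMangoldt_le_log).trans ((Real.log_le_sub_one_of_pos hn).trans (by linarith))
    rw [div_le_div_iff₀ (by positivity) (by positivity), one_mul, pow_succ]
    exact (mul_le_mul_of_nonneg_right hΛ (by positivity)).trans_eq (by ring)
  exact hsum.sum_le_tsum (Finset.range K) fun n _ ↦ hnn n

/-- **`primes`: the prime side of the odd tail's autocorrelation** under `ψ ≤ C·x` — for `x₁ < 0`, `m ≥ 2`, `E ≥ 0`, `T` vanishing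
beyond `x₁` with `‖T u‖ ≤ E e^{(m+½)(u−x₁)}` (`u ≤ x₁`) and a Weil test function `g = T − T(−·)` supported in `[−a, a]`, with `ψ(x) ≤ C·x`
on `[0, ∞)` (the `_cheb` sibling file removes the hypothesis):
`‖weilPrimeTerm (g ⋆ g̃)‖ ≤ (2E²/(m+½))·vonMangoldtSum (m+1) + 2E²·√(e^{−2x₁})·C·(e^{−m/(m+1)}/(m+1) + 1/m²)`.
(`E² = M²u₁`, `x₁ = P.x₁`, `C = rsConst` gives `P.primesC + P.cross`, since `u₁·√(e^{−2x₁}) = 1`.) [THETA-CERT-cc6 §D6] -/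
theorem norm_weilPrimeTerm_oddTail_le {T g : ℝ → ℂ} {E x₁ C a : ℝ} {m : ℕ} (hm : 2 ≤ m) (hx₁ : x₁ < 0) (hE : 0 ≤ E)
    (hT0 : ∀ u, x₁ < u → T u = 0)
    (hTE : ∀ u, u ≤ x₁ → ‖T u‖ ≤ E * Real.exp (((m : ℝ) + 1 / 2) * (u - x₁)))
    (hgt : IsWeilTest g) (hsupp : tsupport g ⊆ Icc (-a) a) (hg : ∀ u, g u = T u - T (-u))
    (hC : 0 ≤ C) (hψ : ∀ x : ℝ, 0 ≤ x → ψ x ≤ C * x) :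
    ‖weilPrimeTerm (weilConv g (weilReflect g))‖ ≤
      2 * E ^ 2 / ((m : ℝ) + 1 / 2) * vonMangoldtSum (m + 1) +
        2 * E ^ 2 * Real.sqrt (Real.exp (-2 * x₁)) *
          (C * (Real.exp (-((m : ℝ) / ((m : ℝ) + 1))) / ((m : ℝ) + 1) + 1 / (m : ℝ) ^ 2)) := by
  have hN : 0 < Real.exp (-2 * x₁) := Real.exp_pos _
  have hlogN : Real.log (Real.exp (-2 * x₁)) = -2 * x₁ := Real.log_exp _
  have hS₂ := fun K ↦ ThetaPrime.vonMangoldt_logTail_sum_le (m := m) (by omega) hN hC hψ K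
  have h := ThetaPrime.norm_weilPrimeTerm_le_of_oddTail (by omega) hx₁ hE hT0 hTE hgt hsupp hg
    (fun K ↦ sum_vonMangoldt_div_pow_le hm K) hS₂
  refine h.trans (le_of_eq ?_)
  have hNm : Real.exp (-2 * x₁) ^ m ≠ 0 := pow_ne_zero _ hN.ne'
  have e : Real.exp (-2 * x₁) ^ m * Real.sqrt (Real.exp (-2 * x₁)) *
      (C * (Real.exp (-((m : ℝ) / ((m : ℝ) + 1))) / ((m : ℝ) + 1) + 1 / (m : ℝ) ^ 2) / Real.exp (-2 * x₁) ^ m) =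
      Real.sqrt (Real.exp (-2 * x₁)) * (C * (Real.exp (-((m : ℝ) / ((m : ℝ) + 1))) / ((m : ℝ) + 1) + 1 / (m : ℝ) ^ 2)) := by
    rw [mul_div_assoc', mul_comm (Real.exp (-2 * x₁) ^ m) (Real.sqrt _), mul_assoc, mul_div_assoc,
      mul_div_cancel_left₀ _ hNm]
  rw [mul_assoc (2 * E ^ 2) (Real.exp (-2 * x₁) ^ m * Real.sqrt (Real.exp (-2 * x₁))), e, ← mul_assoc]


end ThetaParams

end Summit.RiemannHypothesis.RiemannHypothesis.Theorems.WeilColumn.ThetaMellin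

end
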